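import Summits.ValiantsHypothesis.ValiantsHypothesis.Theorems.DepthWindowHomLST
import Summits.ValiantsHypothesis.ValiantsHypothesis.Theorems.DepthWindowSlopeRate
import HarnessLib

/-!
# Route `DepthWindow` — the kernel column «Hard(σ), σ < 1» of the slope–rate dial: `HomImmHardAt p q` for `p < q`

Helper file of the route `Theses/DepthWindow.lean` (decomp-valiant workshop, lens 4, generation 9; port plan `PLAN-w2`
R1, third and last file).  The dial of `DepthWindowSlopeRate.lean` tabulates, per relative product-depth
`σ·log₂log₂log₂ m` (`σ = p/q`), whether HOMOGENEOUS circuits (all gate values homogeneous) for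
`IMM_{m,⌊√log₂ m⌋}` of that product-depth must be superpolynomial (`HomImmHardAt p q`); the cell `σ = 2` closes the
crux `PerHardLog3` (`perHardLog3_of_homImmHardAt_two_one`).  The tree's general-circuit engine certifies the
column only for `σ < 1/2` (`perHardBelowHalf`, exponent `d^{μ_Δ}`, `μ_Δ ≈ 2^{-(2Δ+1)}`); the flat engine for
rigid constant terms (`DepthWindowHomFlatRank.lean`, exponent `d^{1/(2^Δ-1)}`, [LimayeSrinivasanTavenas2025] §5
in the set-multilinear setting, [BhargavDuttaSaxena2024] Lemma 7) and its IMM assembly `homLst_geom_solved`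
(`DepthWindowHomLST.lean`) give the whole column `σ < 1`:

* `lin_le_two_pow` : `a w + b ≤ 2^w` once `2(a+b+1) ≤ w`;
* `homFit_eventually` : for `p < q` and every `c`, for all large `L`,
  `(140 (c+1) Δ')^{2^{Δ'+1}} ≤ L` where `Δ' = ⌊p ⌊log₂⌊log₂ L⌋⌋/q⌋ + c + 1` — the threshold `λ = 70 (c+1) Δ'` FITS
  (`λ^{2^{Δ'}-1} 2^{2^{Δ'}} ≤ ⌊√L⌋`) precisely because `2^{Δ'} ≤ 2^{c+1} (log₂log₂ L)^{p/q}` is `o(log₂ √L)` for `σ < 1`;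
* `homImmHardAt_of_lt` : `p < q → HomImmHardAt p q` — with that `λ`, `homLst_geom_solved` gives
  `s·d^d + 1 ≥ 2^{3(c+1)⌊log₂ m⌋} > (m^c + c)·d^d + 1`.

So after this file the dial reads: Hard(σ) PROVED for every σ < 1 for homogeneous circuits (general circuits:
σ < 1/2, `perHardBelowHalf`), OPEN for 1 ≤ σ < 2, and σ = 2 closes `PerHardLog3`.  The ceiling σ = 1 of THIS file is
the geometric threshold sequence (`d^{1/(2^Δ-1)} → ∞` iff `2^Δ = o(log d)`); the support item `HomImmHardSubReach`
(σ ≤ 7/5) needs the lopsided thresholds of [BhargavDuttaSaxena2024] (port plan R2–R4) and is not attempted here.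
Unconditional, 0 sorry, def-free; rung currency only (LADDER-Valiant rung 0) — nothing here bears on `VP ≠ VNP` itself.

References: [LimayeSrinivasanTavenas2025] Cor. 4, §5; [BhargavDuttaSaxena2024] Thm 1.4, Lemma 7.
-/

-- layout Summits/ValiantsHypothesis/ValiantsHypothesis forces the duplicated namespace component
set_option linter.dupNamespace false

namespace Summit.ValiantsHypothesis.ValiantsHypothesis.Theorems.DepthWindow

open MvPolynomial Real Literature.Computability.AlgebraicComplexity ArithCircuit
open Literature.Computability.Complexity

noncomputable section

/-- `2 (n+1)^2 ≤ 2^{2(n+1)}`. -/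
theorem two_mul_sq_le_two_pow (n : ℕ) : 2 * (n + 1) ^ 2 ≤ 2 ^ (2 * (n + 1)) := by
  induction n with
  | zero => norm_num
  | succ n ih =>
    calc 2 * (n + 1 + 1) ^ 2 ≤ 2 * (2 * (n + 1)) ^ 2 :=
          Nat.mul_le_mul_left 2 (Nat.pow_le_pow_left (by omega) 2)
      _ = 4 * (2 * (n + 1) ^ 2) := by ring
      _ ≤ 4 * 2 ^ (2 * (n + 1)) := by omega
      _ = 2 ^ (2 * (n + 1 + 1)) := by
          rw [show 2 * (n + 1 + 1) = 2 * (n + 1) + 2 by ring, pow_add]; ring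

/-- A linear function is eventually below `2^w`: `a w + b ≤ 2^w` once `2 (a + b + 1) ≤ w`. -/
theorem lin_le_two_pow (a b w : ℕ) (hw : 2 * (a + b + 1) ≤ w) : a * w + b ≤ 2 ^ w := by
  obtain ⟨t, rfl⟩ := Nat.exists_eq_add_of_le hw
  clear hw
  induction t with
  | zero =>
    rw [add_zero]
    have h1 : a * (2 * (a + b + 1)) + b ≤ 2 * (a + b + 1) ^ 2 := by nlinarith
    exact h1.trans (two_mul_sq_le_two_pow _)
  | succ t ih =>
    rw [show 2 * (a + b + 1) + (t + 1) = (2 * (a + b + 1) + t) + 1 by ring, pow_succ]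
    have ha : a ≤ 2 ^ (2 * (a + b + 1) + t) := le_trans (by omega) (Nat.lt_two_pow_self).le
    nlinarith

/-- **The threshold fits, eventually** (`σ = p/q < 1`): for all large `L`, with `v = ⌊log₂⌊log₂ L⌋⌋` and
`Δ' = ⌊p v/q⌋ + c + 1`, `(140 (c+1) Δ')^{2^{Δ'+1}} ≤ L`.  The point: `2^{⌊pv/q⌋} · 2^{⌊v/q⌋} ≤ 2^v ≤ log₂ L` because
`p + 1 ≤ q`, and the remaining factor `(v + 2c + 9) 2^{c+2} ≤ 2^{⌊v/q⌋}` is a linear-versus-exponential comparison. -/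
theorem homFit_eventually (p q c : ℕ) (hpq : p < q) : ∃ L₀ : ℕ, ∀ L : ℕ, L₀ ≤ L →
    (140 * (c + 1) * (p * Nat.log 2 (Nat.log 2 L) / q + c + 1)) ^
      2 ^ (p * Nat.log 2 (Nat.log 2 L) / q + c + 1 + 1) ≤ L := by
  have hq : 0 < q := by omega
  -- the linear-vs-exponential threshold
  set a := q * 2 ^ (c + 2) with ha
  set b := (q + 2 * c + 9) * 2 ^ (c + 2) with hb
  set w₀ := 2 * (a + b + 1) with hw₀
  refine ⟨2 ^ 2 ^ (q * (w₀ + 1)), fun L hL => ?_⟩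
  set u := Nat.log 2 L with hu
  set v := Nat.log 2 u with hv
  have hL0 : L ≠ 0 := by
    have : 1 ≤ 2 ^ 2 ^ (q * (w₀ + 1)) := Nat.one_le_two_pow
    omega
  have huge : 2 ^ (q * (w₀ + 1)) ≤ u := Nat.le_log_of_pow_le (by norm_num) hL
  have hu0 : u ≠ 0 := by
    have : 1 ≤ 2 ^ (q * (w₀ + 1)) := Nat.one_le_two_pow
    omega
  have hvge : q * (w₀ + 1) ≤ v := Nat.le_log_of_pow_le (by norm_num) huge
  have h2v : 2 ^ v ≤ u := Nat.pow_log_le_self 2 hu0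
  have h2u : 2 ^ u ≤ L := Nat.pow_log_le_self 2 hL0
  -- `w = ⌊v/q⌋`
  set w := v / q with hw
  have hw₀w : w₀ ≤ w := by
    rw [hw, Nat.le_div_iff_mul_le hq]
    calc w₀ * q ≤ q * (w₀ + 1) := by nlinarith
      _ ≤ v := hvge
  have hvw : v < q * (w + 1) := by
    have h1 : q * w + v % q = v := Nat.div_add_mod v q
    have h2 := Nat.mod_lt v hq
    have h3 : q * (w + 1) = q * w + q := by ring
    omega
  -- `⌊pv/q⌋ + w ≤ v` since `p + 1 ≤ q`
  have hpw : p * v / q + w ≤ v := by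
    calc p * v / q + v / q ≤ (p * v + v) / q := Nat.add_div_le_add_div _ _ _
      _ ≤ (q * v) / q := Nat.div_le_div_right (by nlinarith)
      _ = v := Nat.mul_div_cancel_left v hq
  -- the base `A = 140 (c+1) Δ' ≤ 2^{v + 2c + 9}`
  set Δ' := p * v / q + c + 1 with hΔ'
  have hΔ'le : Δ' ≤ v + c + 1 := by
    have : p * v / q ≤ v := le_trans (Nat.le_add_right _ _) hpw
    omega
  have hA : 140 * (c + 1) * Δ' ≤ 2 ^ (v + 2 * c + 9) := by
    have h1 : c + 1 ≤ 2 ^ c := Nat.lt_two_pow_self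
    have h2 : Δ' ≤ 2 ^ (v + c + 1) := hΔ'le.trans (Nat.lt_two_pow_self).le
    have h3 : (140 : ℕ) ≤ 2 ^ 8 := by norm_num
    calc 140 * (c + 1) * Δ' ≤ 2 ^ 8 * 2 ^ c * 2 ^ (v + c + 1) :=
          Nat.mul_le_mul (Nat.mul_le_mul h3 h1) h2
      _ = 2 ^ (v + 2 * c + 9) := by rw [← pow_add, ← pow_add]; congr 1; ring
  -- the exponent `(v + 2c + 9) 2^{Δ'+1} ≤ 2^w 2^{⌊pv/q⌋} ≤ 2^v ≤ u`
  have hlin : (v + 2 * c + 9) * 2 ^ (c + 2) ≤ 2 ^ w := by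
    calc (v + 2 * c + 9) * 2 ^ (c + 2) ≤ (q * (w + 1) + 2 * c + 9) * 2 ^ (c + 2) :=
          Nat.mul_le_mul_right _ (by omega)
      _ = a * w + b := by rw [ha, hb]; ring
      _ ≤ 2 ^ w := lin_le_two_pow a b w hw₀w
  have hexp : (v + 2 * c + 9) * 2 ^ (Δ' + 1) ≤ u := by
    have e1 : 2 ^ (Δ' + 1) = 2 ^ (c + 2) * 2 ^ (p * v / q) := by
      rw [hΔ', ← pow_add]; congr 1; ring
    calc (v + 2 * c + 9) * 2 ^ (Δ' + 1) = (v + 2 * c + 9) * 2 ^ (c + 2) * 2 ^ (p * v / q) := by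
          rw [e1, mul_assoc]
      _ ≤ 2 ^ w * 2 ^ (p * v / q) := Nat.mul_le_mul_right _ hlin
      _ = 2 ^ (p * v / q + w) := by rw [← pow_add, add_comm]
      _ ≤ 2 ^ v := Nat.pow_le_pow_right (by norm_num) hpw
      _ ≤ u := h2v
  -- assemble
  calc (140 * (c + 1) * Δ') ^ 2 ^ (Δ' + 1) ≤ (2 ^ (v + 2 * c + 9)) ^ 2 ^ (Δ' + 1) :=
        Nat.pow_le_pow_left hA _
    _ = 2 ^ ((v + 2 * c + 9) * 2 ^ (Δ' + 1)) := by rw [← pow_mul]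
    _ ≤ 2 ^ u := Nat.pow_le_pow_right (by norm_num) hexp
    _ ≤ L := h2u

/-- The kernel of `homImmHardAt_of_lt`, with the degree `d = ⌊√L⌋` and `L = ⌊log₂ m⌋` as named parameters (so that
the circuit's index type does not depend on them through `m`). [cite: LimayeSrinivasanTavenas2025, Cor. 4] -/
theorem homImmHard_core (p q c : ℕ) (hpq : p < q) {L₀ : ℕ}
    (hL₀ : ∀ L : ℕ, L₀ ≤ L → (140 * (c + 1) * (p * Nat.log 2 (Nat.log 2 L) / q + c + 1)) ^
      2 ^ (p * Nat.log 2 (Nat.log 2 L) / q + c + 1 + 1) ≤ L)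
    (m : ℕ) (hm : 2 ^ max L₀ 100 ≤ m) {d L : ℕ} (hL : L = Nat.log 2 m) (hd : d = Nat.sqrt L)
    (D : ArithCircuit ℂ (Fin d × Fin m × Fin m))
    (hhom : ∀ v ∈ ArithCircuit.gateValues D.gates, ∃ e : ℕ, v.IsHomogeneous e)
    (hD : D.Computes (immPoly m d ℂ)) (hpd : D.productDepth ≤ p * Nat.log 2 (Nat.log 2 L) / q + c) :
    m ^ c + c < D.size := by
  have hq : 0 < q := by omega
  have hLge : max L₀ 100 ≤ L := by rw [hL]; exact Nat.le_log_of_pow_le (by norm_num) hm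
  have hL0 : L₀ ≤ L := le_trans (le_max_left _ _) hLge
  have hL100 : 100 ≤ L := le_trans (le_max_right _ _) hLge
  have hd10 : 10 ≤ d := by rw [hd]; exact Nat.le_sqrt.2 (by omega)
  have hdd : d * d ≤ L := by rw [hd]; exact Nat.sqrt_le L
  have hdn : 10 * d ≤ L := le_trans (Nat.mul_le_mul_right d hd10) hdd
  have hdnm : 10 * d ≤ Nat.log 2 m := hL ▸ hdn
  have hd1 : 1 ≤ d := by omega
  set Δ' := p * Nat.log 2 (Nat.log 2 L) / q + c + 1 with hΔ'
  have hpd' : D.productDepth ≤ Δ' := by omega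
  have hΔ1 : 1 ≤ Δ' := by omega
  -- the fit, in `ℕ` and then in `ℝ`
  have hfitN : (140 * (c + 1) * Δ') ^ 2 ^ (Δ' + 1) ≤ L := hL₀ L hL0
  have hAd : (140 * (c + 1) * Δ') ^ 2 ^ Δ' ≤ d := by
    rw [hd, Nat.le_sqrt', ← pow_mul, ← pow_succ]
    exact hfitN
  have hx : 1 ≤ 70 * (c + 1) * Δ' := by nlinarith
  have hfit : ((70 * (c + 1) * Δ' : ℕ) : ℝ) ^ (2 ^ Δ' - 1) * 2 ^ (2 ^ Δ') ≤ (d : ℝ) := by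
    have h1 : (70 * (c + 1) * Δ') ^ (2 ^ Δ' - 1) * 2 ^ (2 ^ Δ') ≤ (140 * (c + 1) * Δ') ^ 2 ^ Δ' := by
      calc (70 * (c + 1) * Δ') ^ (2 ^ Δ' - 1) * 2 ^ (2 ^ Δ')
          ≤ (70 * (c + 1) * Δ') ^ (2 ^ Δ') * 2 ^ (2 ^ Δ') :=
            Nat.mul_le_mul_right _ (Nat.pow_le_pow_right hx (Nat.sub_le _ _))
        _ = (140 * (c + 1) * Δ') ^ 2 ^ Δ' := by rw [← mul_pow]; congr 1; ring
    exact_mod_cast h1.trans hAd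
  have hlam : (1 : ℝ) ≤ ((70 * (c + 1) * Δ' : ℕ) : ℝ) := by exact_mod_cast hx
  have h := homLst_geom_solved ℂ hΔ1 m d hd1 hlam hfit hdnm D hpd' hhom hD
  rw [← hL] at h
  -- the exponent is at least `3 (c+1) L`
  have hexp : (((3 * (c + 1) * L : ℕ) : ℝ)) ≤
      (L : ℝ) * ((((70 * (c + 1) * Δ' : ℕ) : ℝ)) - 10) / (20 * (Δ' : ℝ)) := by
    have hΔR : (1 : ℝ) ≤ Δ' := by exact_mod_cast hΔ1
    have hLR : (0 : ℝ) ≤ L := Nat.cast_nonneg _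
    have hcR : (0 : ℝ) ≤ c := Nat.cast_nonneg _
    have hkey : (0 : ℝ) ≤ (L : ℝ) * (((c : ℝ) + 1) * Δ' - 1) := mul_nonneg hLR (by nlinarith)
    rw [le_div_iff₀ (by positivity)]
    push_cast
    nlinarith [hkey]
  have hN : 2 ^ (3 * (c + 1) * L) ≤ D.size * d ^ d + 1 := by
    have h1 := (Real.rpow_le_rpow_of_exponent_le one_le_two hexp).trans h
    rw [Real.rpow_natCast] at h1
    exact_mod_cast h1
  -- suppose the circuit were small
  by_contra hs
  push Not at hs
  have hm2 : m < 2 ^ (L + 1) := by rw [hL]; exact Nat.lt_pow_succ_log_self one_lt_two m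
  have hmc : m ^ c ≤ 2 ^ ((L + 1) * c) := by
    rw [pow_mul]; exact Nat.pow_le_pow_left hm2.le c
  have hmcc : m ^ c + c ≤ 2 ^ ((L + 1) * c + c) := by
    have h1 : c + 1 ≤ 2 ^ c := Nat.lt_two_pow_self
    have h2 : 1 ≤ 2 ^ ((L + 1) * c) := Nat.one_le_two_pow
    calc m ^ c + c ≤ 2 ^ ((L + 1) * c) + 2 ^ ((L + 1) * c) * c := by nlinarith
      _ = 2 ^ ((L + 1) * c) * (c + 1) := by ring
      _ ≤ 2 ^ ((L + 1) * c) * 2 ^ c := Nat.mul_le_mul_left _ h1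
      _ = 2 ^ ((L + 1) * c + c) := by rw [← pow_add]
  have hddL : d ^ d ≤ 2 ^ L := by
    calc d ^ d ≤ (2 ^ d) ^ d := Nat.pow_le_pow_left (Nat.lt_two_pow_self).le d
      _ = 2 ^ (d * d) := by rw [← pow_mul]
      _ ≤ 2 ^ L := Nat.pow_le_pow_right (by norm_num) hdd
  have hup : D.size * d ^ d + 1 ≤ 2 ^ ((L + 1) * c + c + L + 1) := by
    have h1 : D.size * d ^ d ≤ 2 ^ ((L + 1) * c + c + L) := by
      rw [pow_add]; exact Nat.mul_le_mul (hs.trans hmcc) hddL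
    have h2 : 1 ≤ 2 ^ ((L + 1) * c + c + L) := Nat.one_le_two_pow
    rw [pow_succ]; omega
  have hfin := (Nat.pow_le_pow_iff_right (by norm_num)).1 (hN.trans hup)
  have hcL : c ≤ c * L := Nat.le_mul_of_pos_right c (by omega)
  nlinarith [hcL]

/-- **Hard(σ) for every σ < 1**: homogeneous circuits (all gate values homogeneous) of product-depth
`≤ ⌊p ⌊log₂⌊log₂⌊log₂ m⌋⌋⌋/q⌋ + c` for `IMM_{m,⌊√⌊log₂ m⌋⌋}` over `ℂ` have size `> m^c + c` for all large `m`, whenever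
`p < q`.  [cite: LimayeSrinivasanTavenas2025, Cor. 4] [cite: BhargavDuttaSaxena2024, Thm 1.4] -/
theorem homImmHardAt_of_lt (p q : ℕ) (hpq : p < q) : HomImmHardAt p q := by
  intro c
  obtain ⟨L₀, hL₀⟩ := homFit_eventually p q c hpq
  exact ⟨2 ^ max L₀ 100, fun m hm D hhom hD hpd => homImmHard_core p q c hpq hL₀ m hm rfl rfl D hhom hD hpd⟩

/-- The cell Hard(1/2) of the dial (homogeneous circuits), as a closed instance. -/
theorem homImmHardAt_one_two : HomImmHardAt 1 2 := homImmHardAt_of_lt 1 2 (by norm_num)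

/-- The cell Hard(9/10) of the dial (homogeneous circuits), as a closed instance. -/
theorem homImmHardAt_nine_ten : HomImmHardAt 9 10 := homImmHardAt_of_lt 9 10 (by norm_num)

end

end Summit.ValiantsHypothesis.ValiantsHypothesis.Theorems.DepthWindow
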